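import Literature.NumberTheory.EllipticCurves.RationalTorsionKernelOfReduction
import Literature.NumberTheory.EllipticCurves.GlobalMinimalModel
import Mathlib.RingTheory.Polynomial.RationalRoot
import HarnessLib

/-!
# A coordinate criterion for «rational torsion misses the kernel of reduction» (Silverman VII.1.3(b), VII.2.2)

Companion of `RationalTorsionKernelOfReduction` (the odd-prime theorem). Here, for EVERY prime (in particular `p = 2`):
for a GLOBALLY MINIMAL Weierstrass equation `W` over a number field `K` and a finite place `v`, a rational affine point
`(x₀, y₀)` with `v`-integral `x₀` does not map into the kernel of reduction `E₁(K̄_v) = W.localKernelOfReduction v`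
(`not_mem_localKernelOfReduction_of_valuation_le_one`); hence the hypothesis (T₁) of the `H46` kernel programme
(`Summits/…/ByReductionTypeAtTwoTorsionEulerCharH46OfT1`) follows from the checkable condition «every rational point of `E`
whose image is `p`-power torsion has `v`-integral `x`-coordinate on `W`» (`t1_of_forall_valuation_le_one`).

The input is the `r`-part of Silverman VII.1.3(b) (`exists_algebraMap_eq_r_of_isIntegral`, over any UFD `R` with fraction
field `K`: if `W` and `C • W` are `R`-integral and `u ∈ R` then `r ∈ R`, since `4r` and `3r` are roots of monic polynomials over `R`
coming from the `b₆` and `b₈` transformation formulae), applied to the chosen change of variables from `W ⊗ K_v` to the tree's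
minimal model at `v` (`minimalChange_u_r_integral`: both are minimal, so `u ∈ 𝓞_vˣ` by `exists_algebraMap_eq_u_of_isMinimal`), and
the `x`-coordinate bridge `one_lt_norm_toX_of_mem_localKernelOfReduction` of the companion file (`x' = u⁻²(x₀ − r)`).
THEOREMS ONLY. [cite: SilvermanAEC2009, Prop. VII.1.3(b) (proof, p. 186), III.1 Table 3.1, Prop. VII.2.2]
-/

noncomputable section

open scoped Classical NumberField
open NumberField IsDedekindDomain Field WeierstrassCurve Literature.NumberTheory.EllipticCurves
  Literature.NumberTheory.GaloisRepresentations Polynomial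

namespace Literature.NumberTheory.EllipticCurves.RationalTorsionKernelOfReduction

/-- **Silverman VII.1.3(b), the `r`-part**: if `W` and `C • W` both have `R`-integral coefficients (`R` a UFD with fraction field
`K`) and `u ∈ R`, then `r ∈ R`: `4r` is a root of the monic cubic `X³ + b₂X² + 8b₄X + 16(b₆ − u⁶b₆')` and `3r` of the monic quartic
`X⁴ + b₂X³ + 9b₄X² + 27b₆X + 27(b₈ − u⁸b₈')` over `R` (the `b₆`, `b₈` transformation formulae), so `r = 4r − 3r ∈ R`.
[cite: SilvermanAEC2009, proof of Prop. VII.1.3(b), p. 186; III.1 Table 3.1] -/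
theorem exists_algebraMap_eq_r_of_isIntegral (R : Type*) [CommRing R] [IsDomain R] [UniqueFactorizationMonoid R]
    {K : Type*} [Field K] [Algebra R K] [IsFractionRing R K]
    (W : WeierstrassCurve K) [hW : W.IsIntegral R] (C : VariableChange K) [hC : (C • W).IsIntegral R]
    (hu : ∃ a : R, algebraMap R K a = C.u) : ∃ a : R, algebraMap R K a = C.r := by
  obtain ⟨a, ha⟩ := hu
  obtain ⟨β₂, hβ₂⟩ : ∃ x : R, algebraMap R K x = W.b₂ := ⟨_, integralModel_b₂_eq R W⟩
  obtain ⟨β₄, hβ₄⟩ : ∃ x : R, algebraMap R K x = W.b₄ := ⟨_, integralModel_b₄_eq R W⟩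
  obtain ⟨β₆, hβ₆⟩ : ∃ x : R, algebraMap R K x = W.b₆ := ⟨_, integralModel_b₆_eq R W⟩
  obtain ⟨β₈, hβ₈⟩ : ∃ x : R, algebraMap R K x = W.b₈ := ⟨_, integralModel_b₈_eq R W⟩
  obtain ⟨β₆', hβ₆'⟩ : ∃ x : R, algebraMap R K x = (C • W).b₆ := ⟨_, integralModel_b₆_eq R (C • W)⟩
  obtain ⟨β₈', hβ₈'⟩ : ∃ x : R, algebraMap R K x = (C • W).b₈ := ⟨_, integralModel_b₈_eq R (C • W)⟩
  have hinv : (C.u : K) * (C.u⁻¹ : Kˣ) = 1 := Units.mul_inv C.u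
  -- `u⁶ b₆' = b₆ + 2 r b₄ + r² b₂ + 4 r³`, `u⁸ b₈' = b₈ + 3 r b₆ + 3 r² b₄ + r³ b₂ + 3 r⁴`
  have h6 : (C.u : K) ^ 6 * (C • W).b₆ = W.b₆ + 2 * C.r * W.b₄ + C.r ^ 2 * W.b₂ + 4 * C.r ^ 3 := by
    rw [variableChange_b₆, ← mul_assoc, ← mul_pow, hinv, one_pow, one_mul]
  have h8 : (C.u : K) ^ 8 * (C • W).b₈ =
      W.b₈ + 3 * C.r * W.b₆ + 3 * C.r ^ 2 * W.b₄ + C.r ^ 3 * W.b₂ + 3 * C.r ^ 4 := by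
    rw [variableChange_b₈, ← mul_assoc, ← mul_pow, hinv, one_pow, one_mul]
  rw [← ha, ← hβ₆', ← hβ₂, ← hβ₄, ← hβ₆] at h6
  rw [← ha, ← hβ₈', ← hβ₂, ← hβ₄, ← hβ₆, ← hβ₈] at h8
  -- `4r ∈ R`
  obtain ⟨m, hm, -⟩ := exists_integer_of_is_root_of_monic (A := R) (K := K)
    (p := X ^ 3 + Polynomial.C β₂ * X ^ 2 + Polynomial.C (8 * β₄) * X + Polynomial.C (16 * (β₆ - a ^ 6 * β₆')))
    (by monicity!) (r := 4 * C.r) (by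
      simp only [map_add, map_mul, map_pow, aeval_X, aeval_C, map_sub, map_ofNat]
      linear_combination (-16 : K) * h6)
  -- `3r ∈ R`
  obtain ⟨n, hn, -⟩ := exists_integer_of_is_root_of_monic (A := R) (K := K)
    (p := X ^ 4 + Polynomial.C β₂ * X ^ 3 + Polynomial.C (9 * β₄) * X ^ 2 + Polynomial.C (27 * β₆) * X +
      Polynomial.C (27 * (β₈ - a ^ 8 * β₈')))
    (by monicity!) (r := 3 * C.r) (by
      simp only [map_add, map_mul, map_pow, aeval_X, aeval_C, map_sub, map_ofNat]
      linear_combination (-27 : K) * h8)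
  exact ⟨m - n, by rw [map_sub, ← hm, ← hn]; ring⟩

variable {K : Type} [Field K] [NumberField K] (W : WeierstrassCurve K) [W.IsElliptic] [W.IsGloballyMinimal]
  (v : HeightOneSpectrum (𝓞 K))

/-- For a GLOBALLY MINIMAL `W`, the chosen local change of variables to the minimal model at `v` has `u ∈ 𝓞_vˣ` and `r ∈ 𝓞_v`
(Silverman VII.1.3(b)): both `W ⊗ K_v` and the chosen model are minimal at `v`. [cite: SilvermanAEC2009, Prop. VII.1.3(b)] -/
theorem minimalChange_u_r_integral :
    (∃ a : v.adicCompletionIntegers K, algebraMap _ (v.adicCompletion K) a =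
        ↑(((W.baseChange (v.adicCompletion K)).exists_isMinimal (v.adicCompletionIntegers K)).choose.u⁻¹)) ∧
      ∃ a : v.adicCompletionIntegers K, algebraMap _ (v.adicCompletion K) a =
        ((W.baseChange (v.adicCompletion K)).exists_isMinimal (v.adicCompletionIntegers K)).choose.r := by
  set C := ((W.baseChange (v.adicCompletion K)).exists_isMinimal (v.adicCompletionIntegers K)).choose with hC
  haveI hmin : ((W.baseChange (v.adicCompletion K))).IsMinimal (v.adicCompletionIntegers K) :=
    IsGloballyMinimal.isMinimal v
  haveI hminC : (C • W.baseChange (v.adicCompletion K)).IsMinimal (v.adicCompletionIntegers K) :=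
    ((W.baseChange (v.adicCompletion K)).exists_isMinimal (v.adicCompletionIntegers K)).choose_spec
  haveI : (W.baseChange (v.adicCompletion K)).IsIntegral (v.adicCompletionIntegers K) := by
    simpa using hmin.val_Δ_maximal.1
  haveI : (C • W.baseChange (v.adicCompletion K)).IsIntegral (v.adicCompletionIntegers K) := by
    simpa using hminC.val_Δ_maximal.1
  have hΔ : (W.baseChange (v.adicCompletion K)).Δ ≠ 0 := by
    rw [baseChange, map_Δ]
    exact (_root_.map_ne_zero _).mpr W.isUnit_Δ.ne_zero
  obtain ⟨hu, hui⟩ := exists_algebraMap_eq_u_of_isMinimal (v.adicCompletionIntegers K)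
    (W.baseChange (v.adicCompletion K)) C hΔ
  exact ⟨hui, exists_algebraMap_eq_r_of_isIntegral (v.adicCompletionIntegers K) (W.baseChange (v.adicCompletion K)) C hu⟩

/-- **The coordinate criterion.** For a globally minimal `W` and a rational affine point `(x₀, y₀)` with `v`-INTEGRAL `x₀`, the image
in `E(K̄_v)` does NOT lie in the kernel of reduction `E₁(K̄_v)` (its `x`-coordinate on the minimal model, `u⁻²(x₀ − r)` with
`u ∈ 𝓞_vˣ`, `r ∈ 𝓞_v`, is `v`-integral). [cite: SilvermanAEC2009, Prop. VII.2.2, Prop. VII.1.3(b)] -/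
theorem not_mem_localKernelOfReduction_of_valuation_le_one {x₀ y₀ : K} (h : W.toAffine.Nonsingular x₀ y₀)
    (hx : v.valuation K x₀ ≤ 1) :
    pointsMap W (v.adicCompletion K) (toGeomPoints W (.some x₀ y₀ h)) ∉ W.localKernelOfReduction v := by
  intro hE
  have hlt := one_lt_norm_toX_of_mem_localKernelOfReduction W v h hE
  obtain ⟨⟨b, hb⟩, ⟨c, hc⟩⟩ := minimalChange_u_r_integral W v
  rw [VariableChange.toX_def, VariableChange.map, Units.coe_map_inv, MonoidHom.coe_coe, Algebra.algebraMap_self,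
    RingHom.id_apply, RingHom.id_apply] at hlt
  have hx' : ‖algebraMap K (v.adicCompletion K) x₀‖ ≤ 1 := by
    rw [LocalPoints.norm_le_one_iff_mem, HeightOneSpectrum.mem_adicCompletionIntegers]
    change Valued.v ((x₀ : K) : v.adicCompletion K) ≤ 1
    rw [HeightOneSpectrum.valuedAdicCompletion_eq_valuation']
    exact hx
  have hb' : ‖(↑(((W.baseChange (v.adicCompletion K)).exists_isMinimal (v.adicCompletionIntegers K)).choose.u⁻¹) :
      v.adicCompletion K)‖ ≤ 1 := by
    rw [← hb]; exact (LocalPoints.norm_le_one_iff_mem v _).mpr (SetLike.coe_mem b)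
  have hc' : ‖((W.baseChange (v.adicCompletion K)).exists_isMinimal (v.adicCompletionIntegers K)).choose.r‖ ≤ 1 := by
    rw [← hc]; exact (LocalPoints.norm_le_one_iff_mem v _).mpr (SetLike.coe_mem c)
  have hle : ‖(↑(((W.baseChange (v.adicCompletion K)).exists_isMinimal (v.adicCompletionIntegers K)).choose.u⁻¹) :
      v.adicCompletion K) ^ 2 * (algebraMap K (v.adicCompletion K) x₀ -
        ((W.baseChange (v.adicCompletion K)).exists_isMinimal (v.adicCompletionIntegers K)).choose.r)‖ ≤ 1 := by
    rw [norm_mul, norm_pow]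
    refine mul_le_one₀ (pow_le_one₀ (norm_nonneg _) hb') (norm_nonneg _) ?_
    rw [sub_eq_add_neg]
    refine (IsUltrametricDist.norm_add_le_max _ _).trans (max_le hx' ?_)
    rw [norm_neg]; exact hc'
  exact absurd hlt (not_lt.mpr hle)

/-- **(T₁) from the coordinate criterion** (every prime, in particular `p = 2`): if every non-zero rational affine point of `E`
whose image in `E(K̄)` is `p`-power torsion has a `v`-integral `x`-coordinate on the globally minimal model `W`, then (T₁) holds at
`v`: every `Γ_K`-fixed `p`-power-torsion point of `E(K̄)` mapping into `E₁(K̄_v)` is `0`. [cite: SilvermanAEC2009, Prop. VII.2.2, VIII.§1] -/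
theorem t1_of_forall_valuation_le_one (p : ℕ)
    (H : ∀ (x₀ y₀ : K) (h : W.toAffine.Nonsingular x₀ y₀),
      (∃ t : ℕ, p ^ t • toGeomPoints W (.some x₀ y₀ h) = 0) → v.valuation K x₀ ≤ 1) :
    ∀ P : W.geomPoints, (∀ σ : absoluteGaloisGroup K, σ • P = P) → (∃ t : ℕ, p ^ t • P = 0) →
      pointsMap W (v.adicCompletion K) P ∈ W.localKernelOfReduction v → P = 0 := by
  intro P hfix htors hE
  obtain ⟨P₀, rfl⟩ := (W.mem_range_toGeomPoints_iff P).2 (MulAction.mem_fixedPoints.2 hfix)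
  rcases P₀ with _ | ⟨x₀, y₀, h⟩
  · exact (toGeomPoints W).map_zero
  · exact (not_mem_localKernelOfReduction_of_valuation_le_one W v h (H x₀ y₀ h htors) hE).elim


/-! ## The order-`p` form of the criterion, and the `2`-division cubic certificate (appended, tower-1 GEN 36)

Since `E₁(K̄_v)` is a subgroup, a rational `p`-power torsion point mapping into it has a multiple of exact order `p` mapping
into it; so in (T₁) it suffices to control the rational points `P` with `p • P = 0`. For `p = 2` these are the points
`(x, y)` with `2y + a₁x + a₃ = 0`, whose abscissa is a root of the `2`-division cubic `ψ₂ = 4x³ + b₂x² + 2b₄x + b₆`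
(Silverman III.2.3 / Ex. 3.7); the rational-root certificate pinning the abscissa lives with the consumer
(`Summits/…/ByReductionTypeAtTwoTorsionEulerCharH46TwoTorsionCert`). [cite: SilvermanAEC2009, Prop. VII.2.2, III.2.3(d), Ex. 3.7] -/

/-- **(T₁) from the ORDER-`p` coordinate criterion**: if every rational affine point `P = (x₀, y₀)` of the globally minimal `W`
with `p • P = 0` has `v`-integral `x₀`, then (T₁) holds at `v` (every `Γ_K`-fixed `p`-power-torsion point of `E(K̄)` mapping into
`E₁(K̄_v)` is `0`): a counterexample `P` of order `p^{s+1}` yields the order-`p` counterexample `p^s • P` (the kernel of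
reduction is a subgroup). [cite: SilvermanAEC2009, Prop. VII.2.2, VIII.§1] -/
theorem t1_of_forall_prime_nsmul_valuation_le_one (p : ℕ)
    (H : ∀ (x₀ y₀ : K) (h : W.toAffine.Nonsingular x₀ y₀),
      p • (WeierstrassCurve.Affine.Point.some x₀ y₀ h : W.toAffine.Point) = 0 → v.valuation K x₀ ≤ 1) :
    ∀ P : W.geomPoints, (∀ σ : absoluteGaloisGroup K, σ • P = P) → (∃ t : ℕ, p ^ t • P = 0) →
      pointsMap W (v.adicCompletion K) P ∈ W.localKernelOfReduction v → P = 0 := by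
  intro P hfix htors hE
  obtain ⟨P₀, rfl⟩ := (W.mem_range_toGeomPoints_iff P).2 (MulAction.mem_fixedPoints.2 hfix)
  by_contra hP0
  obtain ⟨t, ht⟩ := htors
  have ht0 : p ^ t • P₀ = 0 := toGeomPoints_injective W (by rw [map_nsmul, map_zero]; exact ht)
  have hex : ∃ n : ℕ, p ^ n • P₀ = 0 := ⟨t, ht0⟩
  -- the least `m` with `p ^ m • P₀ = 0` is positive
  have hm := Nat.find_spec hex
  have hm0 : Nat.find hex ≠ 0 := by
    intro h0
    rw [h0, pow_zero, one_nsmul] at hm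
    exact hP0 (by rw [hm, map_zero])
  obtain ⟨s, hs⟩ := Nat.exists_eq_add_one_of_ne_zero hm0
  have hQ0 : p ^ s • P₀ ≠ 0 := Nat.find_min hex (by rw [hs]; exact lt_add_one s)
  have hpQ : p • (p ^ s • P₀) = 0 := by rw [← mul_nsmul, ← pow_succ, ← hs]; exact hm
  -- the order-`p` point `p ^ s • P₀ = (x, y)` has integral `x`, yet maps into `E₁`
  obtain ⟨x, y, h, hxy⟩ : ∃ (x y : K) (h : W.toAffine.Nonsingular x y), p ^ s • P₀ = .some x y h := by
    rcases hQ : p ^ s • P₀ with _ | ⟨x, y, h⟩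
    · exact (hQ0 hQ).elim
    · exact ⟨x, y, h, rfl⟩
  have hx : v.valuation K x ≤ 1 := H x y h (by rw [← hxy]; exact hpQ)
  refine not_mem_localKernelOfReduction_of_valuation_le_one W v h hx ?_
  rw [← hxy, map_nsmul, map_nsmul]
  exact AddSubgroup.nsmul_mem _ hE _

/-- **A point `P = (x, y)` with `2 • P = 0` has `2y + a₁x + a₃ = 0`** (`P = −P = (x, −y − a₁x − a₃)`), over any field.
[cite: SilvermanAEC2009, III.2.3 (negation formula)] -/
theorem two_mul_add_eq_zero_of_two_nsmul_eq_zero {F : Type*} [Field F] (X : WeierstrassCurve F) {x y : F}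
    (h : X.toAffine.Nonsingular x y) (h2 : 2 • (WeierstrassCurve.Affine.Point.some x y h : X.toAffine.Point) = 0) :
    2 * y + X.a₁ * x + X.a₃ = 0 := by
  rw [two_nsmul, add_eq_zero_iff_eq_neg, WeierstrassCurve.Affine.Point.neg_some,
    WeierstrassCurve.Affine.Point.some.injEq] at h2
  have hy : y = -y - X.a₁ * x - X.a₃ := h2.2
  linear_combination hy

/-- **The abscissa of a point of order `2` is a root of the `2`-division cubic** `ψ₂ = 4x³ + b₂x² + 2b₄x + b₆`
(`(2y + a₁x + a₃)² = ψ₂(x)` on the curve). [cite: SilvermanAEC2009, III.2.3(d), Ex. 3.7] -/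
theorem twoTorsionPolynomial_eval_eq_zero_of_two_nsmul_eq_zero {F : Type*} [Field F] (X : WeierstrassCurve F) {x y : F}
    (h : X.toAffine.Nonsingular x y) (h2 : 2 • (WeierstrassCurve.Affine.Point.some x y h : X.toAffine.Point) = 0) :
    4 * x ^ 3 + X.b₂ * x ^ 2 + 2 * X.b₄ * x + X.b₆ = 0 := by
  have hl := two_mul_add_eq_zero_of_two_nsmul_eq_zero X h h2
  have heq : y ^ 2 + X.a₁ * x * y + X.a₃ * y = x ^ 3 + X.a₂ * x ^ 2 + X.a₄ * x + X.a₆ :=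
    (WeierstrassCurve.Affine.equation_iff _ _).1 h.left
  simp only [WeierstrassCurve.b₂, WeierstrassCurve.b₄, WeierstrassCurve.b₆]
  linear_combination (2 * y + X.a₁ * x + X.a₃) * hl - 4 * heq


/-- **The abscissa of a rational point of order `2`, read in `E(K̄)`, is a root of `ψ₂`** (`E(K) ↪ E(K̄)` is an injective
homomorphism, so `2 • P = 0` may be tested after the embedding — the currency of (T₁)). [cite: SilvermanAEC2009, III.2.3(d), Ex. 3.7, VIII.§1] -/
theorem twoTorsionPolynomial_eval_eq_zero_of_two_nsmul_toGeomPoints_eq_zero {F : Type*} [Field F] (X : WeierstrassCurve F)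
    {x y : F} (h : X.toAffine.Nonsingular x y) (h2 : 2 • WeierstrassCurve.toGeomPoints X (.some x y h) = 0) :
    4 * x ^ 3 + X.b₂ * x ^ 2 + 2 * X.b₄ * x + X.b₆ = 0 :=
  twoTorsionPolynomial_eval_eq_zero_of_two_nsmul_eq_zero X h
    (WeierstrassCurve.toGeomPoints_injective X (by rw [map_nsmul, map_zero]; exact h2))

/-- **(T₁) from the ORDER-`p` coordinate criterion, `E(K̄)`-currency**: the hypothesis of
`t1_of_forall_prime_nsmul_valuation_le_one` with `p • P = 0` tested after the embedding `E(K) ↪ E(K̄)` (so that consumers never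
mention the group law of `E(K)` and its decidability instance). [cite: SilvermanAEC2009, Prop. VII.2.2, VIII.§1] -/
theorem t1_of_forall_prime_nsmul_toGeomPoints_valuation_le_one (p : ℕ)
    (H : ∀ (x₀ y₀ : K) (h : W.toAffine.Nonsingular x₀ y₀),
      p • WeierstrassCurve.toGeomPoints W (.some x₀ y₀ h) = 0 → v.valuation K x₀ ≤ 1) :
    ∀ P : W.geomPoints, (∀ σ : absoluteGaloisGroup K, σ • P = P) → (∃ t : ℕ, p ^ t • P = 0) →
      pointsMap W (v.adicCompletion K) P ∈ W.localKernelOfReduction v → P = 0 :=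
  t1_of_forall_prime_nsmul_valuation_le_one W v p fun x₀ y₀ h h0 ↦
    H x₀ y₀ h (by rw [← map_nsmul, h0, map_zero])
end Literature.NumberTheory.EllipticCurves.RationalTorsionKernelOfReduction

end
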